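import Mathlib
import Summits.ResolutionOfSingularities.ResolutionOfSingularities.Theorems.HomologicalConductorPersistenceStaircaseRecords
import HarnessLib

/-!
# Rung S-2 `PersistenceSurface` (stmt-19970), stub C1 (`Sat₄`) — the stage `1/8(1,5)`: the first cyclic quotient
# surface with `ca³ ≠ ca⁴`, now with `ca = ca⁴ = ⋂_{b ∈ {3,6,7}} s̲ann(M_b)` kernel-certified
# (chain W4.4b, seat res-L1-w44b-stub-4 gen 6; T-V package part 24)

[OURS · L1 w44b · rung S-2] Nothing here is a statement of the manuscript under review (Hironaka 2017);
AI-written, weaker than expert review.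

res-L1-w44b-idea-1's SC-TORIC table: at `1/8(1,5)` (`i`-series `5, 2, 1`, duals of the specials `M_3, M_6, M_7`)
`ca³ ⊊ ca⁴ = ca`.  The gen-6 pipeline (parts 15–22) certifies the right-hand side: the record staircases of the eight
weight classes (drop classes all in `{3, 6, 7}`, which is Ω-stable: `M_3 | Ω M_6`, `M_6, M_7 | Ω M_3`) give
**`cohomologyAnnihilator_eight_five`**: `ca(U) = ca⁴(U)` and `x ∈ ca(U) ↔ x ∈ s̲ann(M_3) ∩ s̲ann(M_6) ∩ s̲ann(M_7)`
for `U = k[u,v]^{μ₈(1,5)}` (`ζ` a primitive 8th root of unity, `2 ∈ kˣ`).  All arithmetic side conditions are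
finite and discharged by `decide`.

References: res-L1-w44b-idea-1 SC-TORIC v2 §0/§3 (OURS, memo); folklore.
-/

-- single-problem summit: the doubled namespace component `ResolutionOfSingularities` is forced
set_option linter.dupNamespace false

noncomputable section

open CategoryTheory Literature.RingTheory.CohomologyAnnihilator MvPolynomial
open Summit.ResolutionOfSingularities.ResolutionOfSingularities.Theorems.NoZeno.SandwichCluster
open Summit.ResolutionOfSingularities.ResolutionOfSingularities.Theorems.HomologicalConductor.PersistenceAddCoverFamily
open Summit.ResolutionOfSingularities.ResolutionOfSingularities.Theorems.HomologicalConductor.PersistenceCyclicQuotientIsotypic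
open Summit.ResolutionOfSingularities.ResolutionOfSingularities.Theorems.HomologicalConductor.PersistenceCyclicQuotientIsotypicPieces
open Summit.ResolutionOfSingularities.ResolutionOfSingularities.Theorems.HomologicalConductor.PersistenceStaircaseRecords

universe u

namespace Summit.ResolutionOfSingularities.ResolutionOfSingularities.Theorems.HomologicalConductor.PersistenceCyclicQuotientEightFive

/-- An eventually constant table read through `min` is antitone when its consecutive entries are. [folklore] -/
theorem antitone_table (T : Fin 3 → ℕ) (h : ∀ i : Fin 2, T i.succ ≤ T i.castSucc) :
    Antitone fun s : ℕ => T ⟨min s 2, by omega⟩ := by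
  refine antitone_nat_of_succ_le fun s => ?_
  show T _ ≤ T _
  rcases Nat.lt_or_ge s 2 with hs | hs
  · have e1 : T ⟨min (s + 1) 2, by omega⟩ = T (Fin.succ ⟨s, hs⟩) :=
      congrArg T (Fin.ext (show min (s + 1) 2 = s + 1 by omega))
    have e2 : T ⟨min s 2, by omega⟩ = T (Fin.castSucc ⟨s, hs⟩) :=
      congrArg T (Fin.ext (show min s 2 = s by omega))
    rw [e1, e2]; exact h ⟨s, hs⟩
  · have e1 : T ⟨min (s + 1) 2, by omega⟩ = T ⟨min s 2, by omega⟩ :=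
      congrArg T (Fin.ext (show min (s + 1) 2 = min s 2 by omega))
    rw [e1]

/-- An eventually constant table read through `min` is monotone when its consecutive entries are. [folklore] -/
theorem monotone_table (T : Fin 3 → ℕ) (h : ∀ i : Fin 2, T i.castSucc ≤ T i.succ) :
    Monotone fun s : ℕ => T ⟨min s 2, by omega⟩ := by
  refine monotone_nat_of_le_succ fun s => ?_
  show T _ ≤ T _
  rcases Nat.lt_or_ge s 2 with hs | hs
  · have e1 : T ⟨min (s + 1) 2, by omega⟩ = T (Fin.succ ⟨s, hs⟩) :=
      congrArg T (Fin.ext (show min (s + 1) 2 = s + 1 by omega))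
    have e2 : T ⟨min s 2, by omega⟩ = T (Fin.castSucc ⟨s, hs⟩) :=
      congrArg T (Fin.ext (show min s 2 = s by omega))
    rw [e1, e2]; exact h ⟨s, hs⟩
  · have e1 : T ⟨min (s + 1) 2, by omega⟩ = T ⟨min s 2, by omega⟩ :=
      congrArg T (Fin.ext (show min (s + 1) 2 = min s 2 by omega))
    rw [e1]

variable {k : Type u} [Field k] {ζ : k} (hζ : IsPrimitiveRoot ζ 8) (h8 : ((8 : ℕ) : k) ≠ 0)
variable (U : Subalgebra k (MvPolynomial (Fin 2) k))
variable (hU : ∀ p, p ∈ U ↔ aeval (fun i : Fin 2 => C (ζ ^ (![1, 5] : Fin 2 → ℕ) i) * X i) p = p)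

set_option maxHeartbeats 1600000 in
set_option synthInstance.maxHeartbeats 400000 in
include hζ h8 hU in
/-- **`Sat₄` and the exact centre at `1/8(1,5)`, kernel-certified**: `ca(U) = ca⁴(U)` and
`x ∈ ca(U) ↔ x` stably annihilates `M_3`, `M_6` and `M_7`. [OURS · L1 w44b] -/
theorem cohomologyAnnihilator_eight_five :
    ∃ M : ZMod 8 → Submodule U ((restrictScalarsFunctor U (MvPolynomial (Fin 2) k)).obj
        (ModuleCat.of (MvPolynomial (Fin 2) k) (MvPolynomial (Fin 2) k))),
      (∀ (a : ZMod 8) (p : MvPolynomial (Fin 2) k),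
        (show ((restrictScalarsFunctor U (MvPolynomial (Fin 2) k)).obj
          (ModuleCat.of (MvPolynomial (Fin 2) k) (MvPolynomial (Fin 2) k))) from p) ∈ M a ↔
        aeval (fun i : Fin 2 => C (ζ ^ (![1, 5] : Fin 2 → ℕ) i) * X i) p = C (ζ ^ a.val) * p) ∧
      cohomologyAnnihilator U = cohomologyAnnihilatorOfDegree U 4 ∧
      ∀ x : U, x ∈ cohomologyAnnihilator U ↔
        ∀ t : Fin 3, StablyAnnihilates U x (@ModuleCat.of U _ (M (![3, 6, 7] t)) _ (M (![3, 6, 7] t)).module) := by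
  classical
  have hq : Nat.Coprime 5 8 := by decide
  obtain ⟨M, hM, ⟨e⟩⟩ := exists_isotypic_splitting hζ h8 hq U hU
  -- the record-staircase tables (rows indexed by the class `a : ZMod 8 = Fin 8`, padded to length 3)
  let cT : ZMod 8 → Fin 3 → ℕ := ![![0,0,0], ![1,0,0], ![2,0,0], ![3,1,0], ![4,2,0], ![5,0,0], ![6,1,0], ![7,2,0]]
  let jT : ZMod 8 → Fin 3 → ℕ := ![![0,0,0], ![0,5,5], ![0,2,2], ![0,2,7], ![0,2,4], ![0,1,1], ![0,1,6], ![0,1,3]]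
  let μT : ZMod 8 → ℕ := ![0, 1, 1, 2, 2, 1, 2, 2]
  let JT : ZMod 8 → ℕ := ![0, 5, 2, 7, 4, 1, 6, 3]
  let dT : ZMod 8 → Fin 2 → ZMod 8 := ![![7,7], ![7,7], ![6,6], ![6,7], ![6,6], ![3,3], ![3,7], ![3,6]]
  let ψ' : Fin 3 → ZMod 8 := ![3, 6, 7]
  let sT : ZMod 8 → Fin 2 → Fin 3 := ![![2,2], ![2,2], ![1,1], ![1,2], ![1,1], ![0,0], ![0,2], ![0,1]]
  -- all finite side conditions
  have hc_anti : ∀ a : ZMod 8, ∀ i : Fin 2, cT a i.succ ≤ cT a i.castSucc := by decide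
  have hj_mono : ∀ a : ZMod 8, ∀ i : Fin 2, jT a i.castSucc ≤ jT a i.succ := by decide
  have hcl : ∀ a : ZMod 8, ∀ i : Fin 3, ((cT a i + 5 * jT a i : ℕ) : ZMod 8) = a := by decide
  have hμ : ∀ a : ZMod 8, μT a ≤ 2 := by decide
  have hJ : ∀ a : ZMod 8, ((5 * JT a : ℕ) : ZMod 8) = a := by decide
  have hJlt : ∀ a : ZMod 8, JT a < 8 := by decide
  have hψ : ∀ a : ZMod 8, ∀ t : Fin 2, (t : ℕ) < μT a →
      dT a t = a - ((cT a t.castSucc + 5 * jT a t.succ : ℕ) : ZMod 8) := by decide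
  have hcov : ∀ a : ZMod 8, ∀ i : Fin 8, (i : ℕ) ≤ JT a → ∃ s : Fin 3, (s : ℕ) ≤ μT a ∧ jT a s ≤ i ∧
      cT a s ≤ ((a - ((5 * (i : ℕ) : ℕ) : ZMod 8) : ZMod 8)).val := by decide
  have hsT : ∀ a : ZMod 8, ∀ t : Fin 2, dT a t = ψ' (sT a t) := by decide
  -- the staircase resolutions
  let M' : ZMod 8 → ModuleCat.{u} U := fun a => @ModuleCat.of U _ (M a) _ (M a).module
  let K : ZMod 8 → ModuleCat.{u} U := fun a =>
    ModuleCat.of U (Π t : Fin (μT a), M (dT a ⟨min t 1, by omega⟩))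
  have hK : ∀ a, IsSyzygy 1 (M' a) (K a) := by
    intro a
    refine isSyzygy_one_staircase_of_lt hζ U hU M hM a (μT a) (fun s => cT a ⟨min s 2, by omega⟩)
      (fun s => jT a ⟨min s 2, by omega⟩) (antitone_table _ (hc_anti a)) (monotone_table _ (hj_mono a))
      (fun s => hcl a _) (fun t => dT a ⟨min t 1, by omega⟩) ?_ ?_
    · intro t ht
      have ht2 : t < 2 := lt_of_lt_of_le ht (hμ a)
      have eD : dT a ⟨min t 1, by omega⟩ = dT a ⟨t, ht2⟩ := congrArg (dT a) (Fin.ext (show min t 1 = t by omega))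
      have eC : cT a ⟨min t 2, by omega⟩ = cT a (Fin.castSucc ⟨t, ht2⟩) :=
        congrArg (cT a) (Fin.ext (show min t 2 = t by omega))
      have eJ : jT a ⟨min (t + 1) 2, by omega⟩ = jT a (Fin.succ ⟨t, ht2⟩) :=
        congrArg (jT a) (Fin.ext (show min (t + 1) 2 = t + 1 by omega))
      rw [eD, eC, eJ]
      exact hψ a ⟨t, ht2⟩ ht
    · refine isotypic_le_span_of_cover hζ U hU M hM a (μT a) (JT a) (fun s => cT a ⟨min s 2, by omega⟩)
        (fun s => jT a ⟨min s 2, by omega⟩) (fun s => hcl a _) (hJ a) ?_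
      intro i hi
      obtain ⟨s, hs, hjs, hcs⟩ := hcov a ⟨i, lt_of_le_of_lt hi (hJlt a)⟩ hi
      have es : (⟨min (s : ℕ) 2, by omega⟩ : Fin 3) = s := Fin.ext (show min (s : ℕ) 2 = s by omega)
      refine ⟨s, hs, ?_, ?_⟩
      · rw [congrArg (jT a) es]; exact hjs
      · rw [congrArg (cT a) es]; exact hcs
  -- the certificate
  have hfin : ∀ t, Module.Finite U (M' (ψ' t)) := fun t => finite_isotypic hζ 5 U hU M hM _
  have hKD : ∀ a, IsRetractOfPower (ModuleCat.of U ((Π t, M' (ψ' t)) × U)) (K a) := by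
    intro a
    refine IsRetractOfPower.piFamily (fun t : Fin (μT a) => M' (dT a ⟨min t 1, by omega⟩)) fun t => ?_
    have heq : dT a ⟨min t 1, by omega⟩ = ψ' (sT a ⟨min t 1, by omega⟩) := hsT a _
    refine (isRetractOfPower_fst (ModuleCat.of U (Π t, M' (ψ' t))) (ModuleCat.of U U)).of_isRetractOfPower_gen
      ((isRetractOfPower_eval (fun t : Fin 3 => M' (ψ' t)) (sT a ⟨min t 1, by omega⟩)).of_iso
        (LinearEquiv.toModuleIso (LinearEquiv.ofEq _ _ (by rw [heq]))))
  have hD : ∀ t, ∃ (s : Fin 3) (i : M' (ψ' t) ⟶ K (ψ' s)) (r : K (ψ' s) ⟶ M' (ψ' t)), i ≫ r = 𝟙 (M' (ψ' t)) := by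
    -- `M_3 | K_6` (position 0), `M_6 | K_3` (position 0), `M_7 | K_3` (position 1)
    have hsrc : ∀ t : Fin 3, ∃ (s : Fin 3) (p : Fin (μT (ψ' s))),
        dT (ψ' s) ⟨min (p : ℕ) 1, by omega⟩ = ψ' t := by decide
    intro t
    obtain ⟨s, p, hp⟩ := hsrc t
    let E : M (dT (ψ' s) ⟨min (p : ℕ) 1, by omega⟩) ≃ₗ[U] M (ψ' t) := LinearEquiv.ofEq _ _ (by rw [hp])
    refine ⟨s,
      @ModuleCat.ofHom U _ (M (ψ' t)) (Π t' : Fin (μT (ψ' s)), M (dT (ψ' s) ⟨min (t' : ℕ) 1, by omega⟩))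
        _ (M (ψ' t)).module _ _
        ((LinearMap.single U (fun t' : Fin (μT (ψ' s)) => M (dT (ψ' s) ⟨min (t' : ℕ) 1, by omega⟩)) p) ∘ₗ
          E.symm.toLinearMap),
      @ModuleCat.ofHom U _ (Π t' : Fin (μT (ψ' s)), M (dT (ψ' s) ⟨min (t' : ℕ) 1, by omega⟩)) (M (ψ' t))
        _ _ _ (M (ψ' t)).module (E.toLinearMap ∘ₗ LinearMap.proj p), ?_⟩
    apply ModuleCat.hom_ext
    refine LinearMap.ext fun x => ?_
    change E ((Pi.single p (E.symm x) : Π t' : Fin (μT (ψ' s)), M (dT (ψ' s) ⟨min (t' : ℕ) 1, by omega⟩)) p) = x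
    rw [Pi.single_eq_same, LinearEquiv.apply_symm_apply]
  obtain ⟨h4, hiff⟩ := @cohomologyAnnihilator_eq_four_of_isotypicData k _ 8 _ ζ hζ h8 5 hq U hU (Fin 3) _ M' e
    K hK ψ' hfin hKD hD
  exact ⟨M, hM, h4, hiff⟩

end Summit.ResolutionOfSingularities.ResolutionOfSingularities.Theorems.HomologicalConductor.PersistenceCyclicQuotientEightFive

end
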